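import Mathlib
import Summits.Ventures.PercRepro2.Defs
import Summits.Ventures.PercRepro2.Harris
import Summits.Ventures.PercRepro2.Graph
import Summits.Ventures.PercRepro2.Events
import Summits.Ventures.PercRepro2.BHKAvoidWeighted
import Summits.Ventures.PercRepro2.PsiPendantLemmas
import Summits.Ventures.PercRepro2.PsiUniSure
import Summits.Ventures.PercRepro2.PsiUniExplored
import Summits.Ventures.PercRepro2.PsiBernstein
import Summits.Ventures.PercRepro2.PsiTEdge
import Summits.Ventures.PercRepro2.PsiBernTMark

/-!
# (BERN_f) for the edge at the explored `t`-component that reaches the conditioning vertex `u`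
(PercRepro2, p2)

Let `f` with `ends f = s(t', u)` be the only unpinned edge at the explored `t`-component `Λ` of `p`
(`t' ∈ Λ`; `s, o ∉ Λ`) and let every member of `𝓤` contain `u`.  With `f` open, `u ∈ C_t` is sure,
so on `Q` the vertex `u` is not in `C_s` and the masses `aH, oLH, oHH, Ug, oLU` vanish; the remaining
open-world masses are `q¹ = P⁰(s ↮ u)`, `oL¹ = P⁰(u ↔ o, s ↮ u)`, `oH¹ = P⁰(s ↔ o, s ↮ u)` of the
closed world (`PsiTEdge.lean`).  The mixed Bernstein coefficients collapse to
`T₁ = Ug·(SS·q¹ + (1 − Su)·oL¹ − Su·oH¹)` and `T₂ = q¹·oL¹·Ug`, nonnegative by Harris (P2-G18-BERN.md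
§7b (ii)) — so the frame `psi_slack_nonneg_of_bern_t` is served whenever the exploration reaches `u`.

* `tmarku_q_one`, `tmarku_oL_one`, `tmarku_oH_one`, `tmarku_aH_one`, `tmarku_Ug_one` — the masses with
  `f` pinned open, in the closed world (the null ones through `aH` and `Ug`);
* `psi_bern_t_of_mark_u` — **`0 ≤ T₁` and `0 ≤ T₂` for the edge reaching `u`**.
-/

namespace Summit.Ventures.PercRepro2

section TMarkU

variable {V : Type*} {E : Type*} [Fintype E] [DecidableEq E]
  {R : Type*} [CommRing R] [LinearOrder R] [IsStrictOrderedRing R]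

omit [IsStrictOrderedRing R] in
/-- With `f = (t', u)` open, `Q` is `{s ↮ u}` of the closed world. -/
lemma tmarku_q_one (p : E → R) (ends : E → Sym2 V) (s t t' u : V) (f : E)
    (hf : ends f = s(t', u)) (ht' : Conn ends (fun e => decide (p e = 1)) t t')
    (hs : ¬ Conn ends (fun e => decide (p e = 1)) t s) (hpf1 : p f ≠ 1)
    (hpin : ∀ e, e ≠ f → (∃ v ∈ ends e, Conn ends (fun e => decide (p e = 1)) t v) →
      p e = 0 ∨ p e = 1) :
    prob (Function.update p f 1) (connEvent ends s t)ᶜ =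
      prob (Function.update p f 0) (connEvent ends s u)ᶜ := by
  refine prob_update_one_eq_prob_update_zero_of_respects p f fun ω h0 h1 => ?_
  simp only [Set.mem_compl_iff, mem_connEvent]
  exact not_congr (conn_update_true_s_t_iff hf ht' hs hpf1 hpin h0 h1)

omit [IsStrictOrderedRing R] in
/-- With `f = (t', u)` open and `o` off the explored component, `{o ∈ C_t} ∩ Q` is
`{u ↔ o, s ↮ u}` of the closed world. -/
lemma tmarku_oL_one (p : E → R) (ends : E → Sym2 V) (s t t' o u : V) (f : E)
    (hf : ends f = s(t', u)) (ht' : Conn ends (fun e => decide (p e = 1)) t t')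
    (hs : ¬ Conn ends (fun e => decide (p e = 1)) t s) (hpf1 : p f ≠ 1)
    (hpin : ∀ e, e ≠ f → (∃ v ∈ ends e, Conn ends (fun e => decide (p e = 1)) t v) →
      p e = 0 ∨ p e = 1) (ho : ¬ Conn ends (fun e => decide (p e = 1)) t o) :
    prob (Function.update p f 1) (clusterInEvent ends t {W : Set V | o ∈ W} ∩
      (connEvent ends s t)ᶜ) =
      prob (Function.update p f 0) (connEvent ends u o ∩ (connEvent ends s u)ᶜ) := by
  refine prob_update_one_eq_prob_update_zero_of_respects p f fun ω h0 h1 => ?_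
  simp only [Set.mem_inter_iff, mem_clusterInEvent, Set.mem_setOf_eq, mem_cluster,
    Set.mem_compl_iff, mem_connEvent]
  constructor
  · rintro ⟨hto, hst⟩
    rcases (conn_update_true_t_iff hf ht' hpf1 hpin h0 h1 o).1 hto with h | h
    · exact absurd h ho
    · exact ⟨h, (not_congr (conn_update_true_s_t_iff hf ht' hs hpf1 hpin h0 h1)).1 hst⟩
  · rintro ⟨huo, hsu⟩
    exact ⟨(conn_update_true_t_iff hf ht' hpf1 hpin h0 h1 o).2 (Or.inr huo), (not_congr (conn_update_true_s_t_iff hf ht' hs hpf1 hpin h0 h1)).2 hsu⟩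

omit [IsStrictOrderedRing R] in
/-- With `f = (t', u)` open, `{o ∈ C_s} ∩ Q` is `{s ↔ o, s ↮ u}` of the closed world. -/
lemma tmarku_oH_one (p : E → R) (ends : E → Sym2 V) (s t t' o u : V) (f : E)
    (hf : ends f = s(t', u)) (ht' : Conn ends (fun e => decide (p e = 1)) t t')
    (hs : ¬ Conn ends (fun e => decide (p e = 1)) t s) (hpf1 : p f ≠ 1)
    (hpin : ∀ e, e ≠ f → (∃ v ∈ ends e, Conn ends (fun e => decide (p e = 1)) t v) →
      p e = 0 ∨ p e = 1) :
    prob (Function.update p f 1) (clusterInEvent ends s {W : Set V | o ∈ W} ∩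
      (connEvent ends s t)ᶜ) =
      prob (Function.update p f 0) (clusterInEvent ends s {W : Set V | o ∈ W} ∩
        (connEvent ends s u)ᶜ) := by
  refine prob_update_one_eq_prob_update_zero_of_respects p f fun ω h0 h1 => ?_
  simp only [Set.mem_inter_iff, mem_clusterInEvent, Set.mem_setOf_eq, mem_cluster,
    Set.mem_compl_iff, mem_connEvent]
  constructor
  · rintro ⟨hso, hst⟩
    exact ⟨(conn_update_true_s_iff_of_not_conn hf ht' hs hpf1 hpin h0 h1 hst o).1 hso, fun h => hst ((conn_update_true_s_t_iff hf ht' hs hpf1 hpin h0 h1).2 h)⟩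
  · rintro ⟨hso, hsu⟩
    have hst : ¬ Conn ends (Function.update ω f true) s t := fun h => hsu ((conn_update_true_s_t_iff hf ht' hs hpf1 hpin h0 h1).1 h)
    exact ⟨(conn_update_true_s_iff_of_not_conn hf ht' hs hpf1 hpin h0 h1 hst o).2 hso, hst⟩

omit [IsStrictOrderedRing R] in
/-- With `f = (t', u)` open, `{u ∈ C_s} ∩ Q` is null. -/
lemma tmarku_aH_one (p : E → R) (ends : E → Sym2 V) (s t t' u : V) (f : E)
    (hf : ends f = s(t', u)) (ht' : Conn ends (fun e => decide (p e = 1)) t t')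
    (hs : ¬ Conn ends (fun e => decide (p e = 1)) t s) (hpf1 : p f ≠ 1)
    (hpin : ∀ e, e ≠ f → (∃ v ∈ ends e, Conn ends (fun e => decide (p e = 1)) t v) →
      p e = 0 ∨ p e = 1) :
    prob (Function.update p f 1) (connEvent ends s u ∩ (connEvent ends s t)ᶜ) = 0 := by
  rw [prob_update_one_eq_prob_update_zero_of_respects p f (A' := (∅ : Set (Config E)))
    fun ω h0 h1 => ?_]
  · exact prob_empty _
  simp only [Set.mem_inter_iff, Set.mem_compl_iff, mem_connEvent, Set.mem_empty_iff_false,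
    iff_false, not_and, not_not]
  intro hsu
  by_contra hst
  exact hst ((conn_update_true_s_t_iff hf ht' hs hpf1 hpin h0 h1).2 ((conn_update_true_s_iff_of_not_conn hf ht' hs hpf1 hpin h0 h1 hst u).1 hsu))

omit [IsStrictOrderedRing R] in
/-- With `f = (t', u)` open and every member of `𝓤` containing `u`, `{C_s ∈ 𝓤} ∩ Q` is null. -/
lemma tmarku_Ug_one (p : E → R) (ends : E → Sym2 V) (s t t' u : V) (f : E)
    (hf : ends f = s(t', u)) (ht' : Conn ends (fun e => decide (p e = 1)) t t')
    (hs : ¬ Conn ends (fun e => decide (p e = 1)) t s) (hpf1 : p f ≠ 1)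
    (hpin : ∀ e, e ≠ f → (∃ v ∈ ends e, Conn ends (fun e => decide (p e = 1)) t v) →
      p e = 0 ∨ p e = 1) {𝓤 : Set (Set V)} (hU : ∀ W ∈ 𝓤, u ∈ W) :
    prob (Function.update p f 1) (clusterInEvent ends s 𝓤 ∩ (connEvent ends s t)ᶜ) = 0 := by
  rw [prob_update_one_eq_prob_update_zero_of_respects p f (A' := (∅ : Set (Config E)))
    fun ω h0 h1 => ?_]
  · exact prob_empty _
  simp only [Set.mem_inter_iff, mem_clusterInEvent, Set.mem_compl_iff, mem_connEvent,
    Set.mem_empty_iff_false, iff_false, not_and, not_not]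
  intro hUU
  by_contra hst
  have hsu : Conn ends (Function.update ω f true) s u := (mem_cluster.1 (hU _ hUU))
  exact hst ((conn_update_true_s_t_iff hf ht' hs hpf1 hpin h0 h1).2 ((conn_update_true_s_iff_of_not_conn hf ht' hs hpf1 hpin h0 h1 hst u).1 hsu))

/-- **(BERN_f) for the edge at the explored `t`-component reaching `u`.** With `f = (t', u)` the only
unpinned edge at the explored component (`t' ∈ Λ`, `s, o ∉ Λ`) and every member of `𝓤` containing
`u`, the two mixed Bernstein coefficients of the (Ψ)-slack along `f` are nonnegative:
`T₁ = Ug·(SS·q¹ + (1 − Su)·oL¹ − Su·oH¹)`, `T₂ = q¹·oL¹·Ug` (Harris twice). -/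
theorem psi_bern_t_of_mark_u (p : E → R) (hp : IsProbVec p) (ends : E → Sym2 V) (s t t' o u : V) (f : E)
    (hf : ends f = s(t', u)) (ht' : Conn ends (fun e => decide (p e = 1)) t t')
    (hs : ¬ Conn ends (fun e => decide (p e = 1)) t s)
    (ho : ¬ Conn ends (fun e => decide (p e = 1)) t o) (hpf1 : p f ≠ 1)
    (hpin : ∀ e, e ≠ f → (∃ v ∈ ends e, Conn ends (fun e => decide (p e = 1)) t v) →
      p e = 0 ∨ p e = 1) {𝓤 : Set (Set V)} (hU : ∀ W ∈ 𝓤, u ∈ W) :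
    0 ≤ (((prob (Function.update p f 0) (connEvent ends s t)ᶜ - prob (Function.update p f 0) (connEvent ends s u ∩ (connEvent ends s t)ᶜ)) * prob (Function.update p f 0) (clusterInEvent ends t {W : Set V | o ∈ W} ∩ (connEvent ends s t)ᶜ) +
          prob (Function.update p f 0) (connEvent ends s t)ᶜ * (prob (Function.update p f 0) (connEvent ends s u ∩ clusterInEvent ends t {W : Set V | o ∈ W} ∩
          (connEvent ends s t)ᶜ) + prob (Function.update p f 0) (connEvent ends s u ∩ clusterInEvent ends s {W : Set V | o ∈ W} ∩
          (connEvent ends s t)ᶜ)) -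
          prob (Function.update p f 0) (connEvent ends s u ∩ (connEvent ends s t)ᶜ) * prob (Function.update p f 0) (clusterInEvent ends s {W : Set V | o ∈ W} ∩ (connEvent ends s t)ᶜ)) * prob (Function.update p f 1) (clusterInEvent ends s 𝓤 ∩ (connEvent ends s t)ᶜ) +
        (prob (Function.update p f 0) (clusterInEvent ends s 𝓤 ∩ (connEvent ends s t)ᶜ) * (prob (Function.update p f 0) (clusterInEvent ends t {W : Set V | o ∈ W} ∩ (connEvent ends s t)ᶜ) + prob (Function.update p f 0) (connEvent ends s u ∩ clusterInEvent ends t {W : Set V | o ∈ W} ∩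
          (connEvent ends s t)ᶜ) + prob (Function.update p f 0) (connEvent ends s u ∩ clusterInEvent ends s {W : Set V | o ∈ W} ∩
          (connEvent ends s t)ᶜ)) -
          2 * prob (Function.update p f 0) (clusterInEvent ends s 𝓤 ∩ clusterInEvent ends t {W : Set V | o ∈ W} ∩
          (connEvent ends s t)ᶜ) * prob (Function.update p f 0) (connEvent ends s t)ᶜ) * prob (Function.update p f 1) (connEvent ends s t)ᶜ +
        prob (Function.update p f 0) (clusterInEvent ends s 𝓤 ∩ (connEvent ends s t)ᶜ) * (prob (Function.update p f 0) (connEvent ends s t)ᶜ - prob (Function.update p f 0) (connEvent ends s u ∩ (connEvent ends s t)ᶜ)) * prob (Function.update p f 1) (clusterInEvent ends t {W : Set V | o ∈ W} ∩ (connEvent ends s t)ᶜ) -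
        prob (Function.update p f 0) (clusterInEvent ends s 𝓤 ∩ (connEvent ends s t)ᶜ) * (prob (Function.update p f 0) (clusterInEvent ends t {W : Set V | o ∈ W} ∩ (connEvent ends s t)ᶜ) + prob (Function.update p f 0) (clusterInEvent ends s {W : Set V | o ∈ W} ∩ (connEvent ends s t)ᶜ)) * prob (Function.update p f 1) (connEvent ends s u ∩ (connEvent ends s t)ᶜ) +
        prob (Function.update p f 0) (clusterInEvent ends s 𝓤 ∩ (connEvent ends s t)ᶜ) * prob (Function.update p f 0) (connEvent ends s t)ᶜ * (prob (Function.update p f 1) (connEvent ends s u ∩ clusterInEvent ends t {W : Set V | o ∈ W} ∩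
          (connEvent ends s t)ᶜ) + prob (Function.update p f 1) (connEvent ends s u ∩ clusterInEvent ends s {W : Set V | o ∈ W} ∩
          (connEvent ends s t)ᶜ)) -
        prob (Function.update p f 0) (clusterInEvent ends s 𝓤 ∩ (connEvent ends s t)ᶜ) * prob (Function.update p f 0) (connEvent ends s u ∩ (connEvent ends s t)ᶜ) * prob (Function.update p f 1) (clusterInEvent ends s {W : Set V | o ∈ W} ∩ (connEvent ends s t)ᶜ) -
        prob (Function.update p f 0) (connEvent ends s t)ᶜ * prob (Function.update p f 0) (connEvent ends s t)ᶜ * prob (Function.update p f 1) (clusterInEvent ends s 𝓤 ∩ clusterInEvent ends t {W : Set V | o ∈ W} ∩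
          (connEvent ends s t)ᶜ)) ∧
    0 ≤ (((prob (Function.update p f 1) (connEvent ends s t)ᶜ - prob (Function.update p f 1) (connEvent ends s u ∩ (connEvent ends s t)ᶜ)) * prob (Function.update p f 1) (clusterInEvent ends t {W : Set V | o ∈ W} ∩ (connEvent ends s t)ᶜ) +
          prob (Function.update p f 1) (connEvent ends s t)ᶜ * (prob (Function.update p f 1) (connEvent ends s u ∩ clusterInEvent ends t {W : Set V | o ∈ W} ∩
          (connEvent ends s t)ᶜ) + prob (Function.update p f 1) (connEvent ends s u ∩ clusterInEvent ends s {W : Set V | o ∈ W} ∩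
          (connEvent ends s t)ᶜ)) -
          prob (Function.update p f 1) (connEvent ends s u ∩ (connEvent ends s t)ᶜ) * prob (Function.update p f 1) (clusterInEvent ends s {W : Set V | o ∈ W} ∩ (connEvent ends s t)ᶜ)) * prob (Function.update p f 0) (clusterInEvent ends s 𝓤 ∩ (connEvent ends s t)ᶜ) +
        (prob (Function.update p f 1) (clusterInEvent ends s 𝓤 ∩ (connEvent ends s t)ᶜ) * (prob (Function.update p f 1) (clusterInEvent ends t {W : Set V | o ∈ W} ∩ (connEvent ends s t)ᶜ) + prob (Function.update p f 1) (connEvent ends s u ∩ clusterInEvent ends t {W : Set V | o ∈ W} ∩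
          (connEvent ends s t)ᶜ) + prob (Function.update p f 1) (connEvent ends s u ∩ clusterInEvent ends s {W : Set V | o ∈ W} ∩
          (connEvent ends s t)ᶜ)) -
          2 * prob (Function.update p f 1) (clusterInEvent ends s 𝓤 ∩ clusterInEvent ends t {W : Set V | o ∈ W} ∩
          (connEvent ends s t)ᶜ) * prob (Function.update p f 1) (connEvent ends s t)ᶜ) * prob (Function.update p f 0) (connEvent ends s t)ᶜ +
        prob (Function.update p f 1) (clusterInEvent ends s 𝓤 ∩ (connEvent ends s t)ᶜ) * (prob (Function.update p f 1) (connEvent ends s t)ᶜ - prob (Function.update p f 1) (connEvent ends s u ∩ (connEvent ends s t)ᶜ)) * prob (Function.update p f 0) (clusterInEvent ends t {W : Set V | o ∈ W} ∩ (connEvent ends s t)ᶜ) -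
        prob (Function.update p f 1) (clusterInEvent ends s 𝓤 ∩ (connEvent ends s t)ᶜ) * (prob (Function.update p f 1) (clusterInEvent ends t {W : Set V | o ∈ W} ∩ (connEvent ends s t)ᶜ) + prob (Function.update p f 1) (clusterInEvent ends s {W : Set V | o ∈ W} ∩ (connEvent ends s t)ᶜ)) * prob (Function.update p f 0) (connEvent ends s u ∩ (connEvent ends s t)ᶜ) +
        prob (Function.update p f 1) (clusterInEvent ends s 𝓤 ∩ (connEvent ends s t)ᶜ) * prob (Function.update p f 1) (connEvent ends s t)ᶜ * (prob (Function.update p f 0) (connEvent ends s u ∩ clusterInEvent ends t {W : Set V | o ∈ W} ∩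
          (connEvent ends s t)ᶜ) + prob (Function.update p f 0) (connEvent ends s u ∩ clusterInEvent ends s {W : Set V | o ∈ W} ∩
          (connEvent ends s t)ᶜ)) -
        prob (Function.update p f 1) (clusterInEvent ends s 𝓤 ∩ (connEvent ends s t)ᶜ) * prob (Function.update p f 1) (connEvent ends s u ∩ (connEvent ends s t)ᶜ) * prob (Function.update p f 0) (clusterInEvent ends s {W : Set V | o ∈ W} ∩ (connEvent ends s t)ᶜ) -
        prob (Function.update p f 1) (connEvent ends s t)ᶜ * prob (Function.update p f 1) (connEvent ends s t)ᶜ * prob (Function.update p f 0) (clusterInEvent ends s 𝓤 ∩ clusterInEvent ends t {W : Set V | o ∈ W} ∩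
          (connEvent ends s t)ᶜ)) := by
  have hp0 : IsProbVec (Function.update p f 0) := hp.update f le_rfl zero_le_one
  have hp1 : IsProbVec (Function.update p f 1) := hp.update f zero_le_one le_rfl
  have hω := tmark_pinned_eq p f hpf1
  have hpin0 : ∀ e, (∃ v ∈ ends e, Conn ends (fun e => decide (Function.update p f 0 e = 1)) t v) →
      Function.update p f 0 e = 0 ∨ Function.update p f 0 e = 1 := by
    intro e he
    rw [hω] at he
    by_cases hef : e = f
    · subst hef
      exact Or.inl (by simp)
    · rw [Function.update_of_ne hef]
      exact hpin e hef he
  have hQ0 : prob (Function.update p f 0) (connEvent ends s t) = 0 := by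
    rw [connEvent_comm]
    exact prob_connEvent_eq_zero_of_explored _ ends hpin0 (by rw [hω]; exact hs)
  have ho0 : prob (Function.update p f 0) (connEvent ends t o) = 0 :=
    prob_connEvent_eq_zero_of_explored _ ends hpin0 (by rw [hω]; exact ho)
  have hq0 : prob (Function.update p f 0) (connEvent ends s t)ᶜ = 1 := by
    rw [prob_compl, hQ0, sub_zero]
  have hoL0 : prob (Function.update p f 0) (clusterInEvent ends t {W : Set V | o ∈ W}) = 0 := by
    rw [clusterInEvent_memFamily_eq_connEvent]; exact ho0
  -- the open world
  have e1 := tmarku_q_one p ends s t t' u f hf ht' hs hpf1 hpin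
  have e2 := tmarku_oL_one p ends s t t' o u f hf ht' hs hpf1 hpin ho
  have e3 := tmarku_oH_one p ends s t t' o u f hf ht' hs hpf1 hpin
  have e4 := tmarku_aH_one p ends s t t' u f hf ht' hs hpf1 hpin
  have e7 := tmarku_Ug_one p ends s t t' u f hf ht' hs hpf1 hpin hU
  have e5 : prob (Function.update p f 1) (connEvent ends s u ∩
      clusterInEvent ends t {W : Set V | o ∈ W} ∩ (connEvent ends s t)ᶜ) = 0 := by
    apply le_antisymm _ (prob_nonneg hp1 _)
    rw [← e4]
    refine prob_mono hp1 ?_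
    rw [Set.inter_assoc]
    exact Set.inter_subset_inter_right _ Set.inter_subset_right
  have e6 : prob (Function.update p f 1) (connEvent ends s u ∩
      clusterInEvent ends s {W : Set V | o ∈ W} ∩ (connEvent ends s t)ᶜ) = 0 := by
    apply le_antisymm _ (prob_nonneg hp1 _)
    rw [← e4]
    refine prob_mono hp1 ?_
    rw [Set.inter_assoc]
    exact Set.inter_subset_inter_right _ Set.inter_subset_right
  have e8 : prob (Function.update p f 1) (clusterInEvent ends s 𝓤 ∩
      clusterInEvent ends t {W : Set V | o ∈ W} ∩ (connEvent ends s t)ᶜ) = 0 := by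
    apply le_antisymm _ (prob_nonneg hp1 _)
    rw [← e7]
    refine prob_mono hp1 ?_
    rw [Set.inter_assoc]
    exact Set.inter_subset_inter_right _ Set.inter_subset_right
  rw [e1, e2, e3, e4, e5, e6, e7, e8, hq0]
  simp only [prob_inter_compl_of_eq_zero hp0 hQ0]
  rw [prob_inter_eq_zero_of_right hp0 hoL0, prob_inter_eq_zero_of_right hp0 hoL0, hoL0]
  -- Harris in the closed world
  have hlow : IsLowerSet (connEvent ends s u)ᶜ := (isUpperSet_connEvent ends s u).compl
  have hOH : IsUpperSet (clusterInEvent ends s {W : Set V | o ∈ W}) :=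
    isUpperSet_clusterInEvent ends s (isUpperSet_memFamily o)
  have hSS : prob (Function.update p f 0) (connEvent ends s u) *
      prob (Function.update p f 0) (clusterInEvent ends s {W : Set V | o ∈ W}) ≤
      prob (Function.update p f 0) (connEvent ends s u ∩ clusterInEvent ends s {W : Set V | o ∈ W}) :=
    prob_mul_prob_le_prob_inter hp0 (isUpperSet_connEvent ends s u) hOH
  have hM : prob (Function.update p f 0) (clusterInEvent ends s {W : Set V | o ∈ W} ∩
      (connEvent ends s u)ᶜ) ≤
      prob (Function.update p f 0) (clusterInEvent ends s {W : Set V | o ∈ W}) *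
        prob (Function.update p f 0) (connEvent ends s u)ᶜ := by
    have h := prob_inter_le_prob_mul_prob_of_isLowerSet hp0 hlow hOH
    rw [Set.inter_comm, mul_comm] at h
    exact h
  have hUg : 0 ≤ prob (Function.update p f 0) (clusterInEvent ends s 𝓤) := prob_nonneg hp0 _
  have hN : 0 ≤ prob (Function.update p f 0) (connEvent ends s u)ᶜ := prob_nonneg hp0 _
  have hSu : 0 ≤ prob (Function.update p f 0) (connEvent ends s u) := prob_nonneg hp0 _
  have hSu1 : prob (Function.update p f 0) (connEvent ends s u) ≤ 1 := prob_le_one hp0 _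
  have hoL1 : 0 ≤ prob (Function.update p f 0) (connEvent ends u o ∩ (connEvent ends s u)ᶜ) :=
    prob_nonneg hp0 _
  have k1 := mul_nonneg hUg (mul_nonneg hN (sub_nonneg.2 hSS))
  have k2 := mul_nonneg hUg (mul_nonneg hSu (sub_nonneg.2 hM))
  have k3 := mul_nonneg hUg (mul_nonneg (sub_nonneg.2 hSu1) hoL1)
  have k4 := mul_nonneg hN (mul_nonneg hoL1 hUg)
  constructor
  · nlinarith [k1, k2, k3]
  · nlinarith [k4]

end TMarkU

end Summit.Ventures.PercRepro2
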